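import Literature.AnabelianGeometry.EtaleTheta.Discharge.Sec3Prop34CnstOfRlfZ
import Literature.AnabelianGeometry.EtaleTheta.RealifiedDivisorMonoidsOfRlfQ
import Literature.AlgebraicGeometry.Frobenioids.RlfStructure
import Literature.AlgebraicGeometry.Frobenioids.RealificationMonoidOn
import HarnessLib

/-!
# [EtTh] Prop 3.4 (ii) relative to `D^cnst` for the Def. 3.6 (i) data of monoid type `ℚ`
# (`RealifiedDivisorMonoids.ofRlfQ`: `B₀^ℚ = B₀^pf`, `F₀^ℚ = F₀^pf`): what transports from the `B₀`-level,
# and the exact residual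

Proof-only companion (theorems only, no definitions) of `TemperedFrobenioidCnst.lean` (abc-iut-L2-t3) in the
series `Discharge/Sec3*.lean`; sequel to `Discharge/Sec3Prop34CnstOfRlfZ.lean` (monoid type `ℤ`) and
`Discharge/Sec3Prop34CnstOfRlfR.lean` (monoid type `ℝ`, seat abc-iut-w5-d130).
S. Mochizuki, *The étale theta function …*, Publ. RIMS **45** (2009) [EtTh], §3, Proposition 3.4 (ii)
PDF p.74, Definition 3.6 (i) p.76, Theorem 3.7 (iii) pp.79–80 of `paper:doi-10-2977-prims-1234361159`
[cite: MochizukiEtTh2009, Prop 3.4 (ii) p.74]: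

> "`O_L^× ⥲ Ker(B₀(Y^log) → Φ₀^gp(Y^log))`; `O_L^▷ ⥲ B₀(Y^log) ×_{Φ₀^gp(Y^log)} Φ₀(Y^log)`;
> `L^× ⥲ F₀(Y^log) ⊆ B₀(Y^log)`" (Prop. 3.4 (ii)); "`B₀^Λ` for `B₀` (resp. `B₀^pf`; `ℝ·Φ₀^birat`) if
> `Λ = ℤ` (resp. `ℚ`; `ℝ`), `F₀^Λ ⊆ B₀^Λ` for `F₀` (resp. `F₀^pf`; `ℝ·Φ₀^cnst`)" (Def. 3.6 (i)); "(iii) …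
> If, moreover, `Λ ∈ {ℤ, ℚ}`, then this factorization determines a faithful action of the image of
> `Aut_C(A)` in `Aut_{D^cnst}(A^cnst)` on `O^▷(A)`, `O^×(A)`" (Thm. 3.7 (iii)).

Cell abc-iut, layer L2 (row «hP34Λ at the constructed Def. 3.6 (i) data», abc-iut-L2-lead RULINGS/ROWS #8
R69, seat abc-iut-w4-d084; GAP-LEDGER G-w5d124-1).  RESULT, for `T := ofRlfQ dm hpf` (`B₀^ℚ(Y) = B₀(Y)^pf`,
`F₀^ℚ(Y) = F₀(Y)^pf`, `B₀^ℚ → (Φ₀^ℝ)^gp` the extension `divQ` of `B₀ → Φ₀^gp → (Φ₀^rlf)^gp`), of the four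
clauses of `RealifiedDivisorMonoids.Prop34Cnst T cnst`:
* clause 1 — `hP34Λ` at monoid type `ℚ`: "an element of `B₀(Y)^pf` whose image in `(Φ₀^rlf)^gp(Y)` is
  EFFECTIVE lies in `F₀(Y)^pf`" — FOLLOWS from the `B₀`-level Prop. 3.4 (ii) (`DivisorMonoids.Prop34`,
  iso 2: effective locus of `B₀ ⊆ F₀`): for `b = a^{1/n}`, `(divQ b)^n = ι(div₀ a)` is effective, so
  `div₀ a` is effective in `Φ₀(Y)` (`RlfEffective.exists_eq_of`: order embedding `Φ₀^pf ↪ Φ₀^rlf` and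
  saturatedness of `Φ₀`), hence `a ∈ F₀(Y)` and `b ∈ F₀(Y)^pf` (`ofRlfQ_mem_FΛ_of_divΛ_eq_of`);
* clauses 2–3 (NATURALITY through `cnst : D₀ → D^cnst` of the pull-back action on the constants `F₀^pf` and
  on the log-divisors of constants) FOLLOW from the `B₀`-level naturality clauses `Prop34Cnst₀`: roots are
  determined — `B₀^pf(g)` acts on `a^{1/n}` through `B₀(g) a`, and `n`-th powers are injective in
  `Φ₀(Y)^rlf` (`IsPerfFactorial.Rlf.isPerfect`);
* clause 4 (faithfulness, NON-vacuous at `Λ = ℚ`): automorphisms of `Y` acting identically on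
  `Ker(B₀(Y)^pf → (Φ₀^rlf)^gp(Y)) = (O_L^×)^pf` have the same image in `Aut_{D^cnst}(Y^cnst)`.  This is
  NOT a formal consequence of `Prop34Cnst₀` (whose faithfulness clause is on `Ker(B₀ → Φ₀^gp) = O_L^×`:
  `B₀ → B₀^pf` kills torsion — the roots of unity of `L` — so agreement on `(O_L^×)^pf` is agreement on
  `O_L^×` only UP TO TORSION).  It enters here BY NAME as the binder `hQ` — print's own `Λ = ℚ` clause of
  Thm. 3.7 (iii), "faithful action on `(O_L^×)^pf`", stated at the `B₀`-level: automorphisms agreeing on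
  `Ker(div₀)` up to torsion have the same image under `cnst` — and `torsionFaithful_of_prop34Cnst_ofRlfQ`
  shows it is EXACTLY the residual (the two are equivalent).
* `Prop34Cnst.ofRlfQ_of_torsionFaithful` assembles the four clauses; `TemperedFrobenioid.thm37_iii_withCnst_ofRlfQ`
  — hence Theorem 3.7 (iii), as typed, for every tempered Frobenioid over the constructed `Λ = ℚ` data,
  modulo `Prop34` (iso 2), `Prop34Cnst₀` (two naturality clauses) and `hQ`.
HONEST FRAMING: refereed pre-IUT material ([EtTh] 2009); nothing here bears on [IUTchIII] Cor. 3.12; no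
statement of the paper is strengthened; typed ≠ proved — clause 4 for `Λ = ℚ` stays a named hypothesis.
-/

noncomputable section

namespace Literature.AnabelianGeometry.EtaleTheta

open CategoryTheory Opposite Literature.AlgebraicGeometry.Frobenioids

universe u₀ v₀ u₁ v₁ u v w

namespace RealifiedDivisorMonoids.Prop34Cnst

variable {D₀ : Type u} [Category.{v} D₀] {dm : DivisorMonoids.{u, v, w} D₀}
  {hpf : ∀ Y : D₀ᵒᵖ, IsPerfFactorial (dm.Φ₀.obj Y)}
  {Dcnst : Type u₁} [Category.{v₁} Dcnst] {cnst : D₀ ⥤ Dcnst}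

/-! ### Roots: the image of `a^{1/n} ∈ B₀(Y)^pf` raised to the `n`-th power is the image of `a` -/

/-- For `b = a^{1/n} ∈ B₀(Y)^pf`: `(divQ b)^n = ι(div₀ a)` in `(Φ₀(Y)^rlf)^gp` — the `Λ = ℚ` divisor map on
roots is determined by the `Λ = ℤ` one. [cite: MochizukiEtTh2009, Def 3.6 p.76] -/
theorem divQ_mk_pow (Y : D₀ᵒᵖ) (a : dm.B₀.obj Y) (n : ℕ+) :
    divQ dm hpf Y (Perfection.mk a n) ^ (n : ℕ) =
      gpMap ((toRlfNatTrans dm.Φ₀ hpf).app Y).hom (dm.div₀ Y a) := by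
  rw [← map_pow, Perfection.mk_pow_self, divQ_of]
  rfl

/-- If `b = a^{1/n} ∈ B₀(Y)^pf` maps to (the image of) `x ∈ Φ₀(Y)^rlf`, then `div₀ a` maps to `x^n`:
effectivity of the image of a ROOT is effectivity of the image of the radicand.
[cite: MochizukiEtTh2009, Prop 3.4 (ii) p.74] -/
theorem gpMap_div₀_eq_of_pow (Y : D₀ᵒᵖ) (a : dm.B₀.obj Y) (n : ℕ+) (x : (rlfFunctor dm.Φ₀ hpf).obj Y)
    (hbx : divQ dm hpf Y (Perfection.mk a n) = Algebra.GrothendieckGroup.of x) :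
    gpMap ((toRlfNatTrans dm.Φ₀ hpf).app Y).hom (dm.div₀ Y a) =
      Algebra.GrothendieckGroup.of (x ^ (n : ℕ)) := by
  have h := divQ_mk_pow (dm := dm) (hpf := hpf) Y a n
  rw [hbx, ← map_pow] at h
  exact h.symm

/-- Hence, for `b = a^{1/n} ∈ B₀(Y)^pf` with EFFECTIVE image `x` in `(Φ₀(Y)^rlf)^gp`: the log-divisor `div₀ a`
is effective in `Φ₀(Y)` itself — `div₀ a = [x₀]` with `ι(x₀) = x^n` — by `RlfEffective.exists_eq_of`
(order embedding `Φ₀^pf ↪ Φ₀^rlf`, saturatedness of `Φ₀(Y)`). [cite: MochizukiEtTh2009, Prop 3.4 (ii) p.74] -/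
theorem exists_div₀_eq_of_divQ_mk_eq_of (Y : D₀ᵒᵖ) (a : dm.B₀.obj Y) (n : ℕ+)
    (x : (rlfFunctor dm.Φ₀ hpf).obj Y)
    (hbx : divQ dm hpf Y (Perfection.mk a n) = Algebra.GrothendieckGroup.of x) :
    ∃ x₀ : dm.Φ₀.obj Y, dm.div₀ Y a = Algebra.GrothendieckGroup.of x₀ ∧
      x ^ (n : ℕ) = (hpf Y).toRealification (Perfection.of _ x₀) :=
  RlfEffective.exists_eq_of (hpf Y) (dm.div₀ Y a) (x ^ (n : ℕ)) (gpMap_div₀_eq_of_pow Y a n x hbx)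

/-! ### Clause 1: `hP34Λ` at monoid type `ℚ` -/

/-- **Prop. 3.4 (ii), iso 2, at monoid type `ℚ` for the CONSTRUCTED data** (`hP34Λ` of the cell's Cor. 3.8 (i)
sub-DAG, row G-w5d124-1, at `T = ofRlfQ dm hpf`): an element of `B₀^ℚ(Y) = B₀(Y)^pf` whose image in
`(Φ₀^ℝ)^gp(Y) = (Φ₀(Y)^rlf)^gp` is effective lies in `F₀^ℚ(Y) = F₀(Y)^pf` — from the `B₀`-level clause
`Prop34.mem_F₀_of_div₀_mem` ("`O_L^▷ ⥲ B₀ ×_{Φ₀^gp} Φ₀ ⊆ F₀`") applied to the radicand.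
[cite: MochizukiEtTh2009, Prop 3.4 (ii) p.74] -/
theorem ofRlfQ_mem_FΛ_of_divΛ_eq_of
    (h34 : ∀ (Y : D₀ᵒᵖ) (b : dm.B₀.obj Y) (x : dm.Φ₀.obj Y),
      dm.div₀ Y b = Algebra.GrothendieckGroup.of x → b ∈ dm.F₀ Y)
    (Y : D₀ᵒᵖ) (b : (RealifiedDivisorMonoids.ofRlfQ dm hpf).BΛ.obj Y)
    (x : (RealifiedDivisorMonoids.ofRlfQ dm hpf).ΦR.obj Y)
    (hbx : (RealifiedDivisorMonoids.ofRlfQ dm hpf).divΛ Y b = Algebra.GrothendieckGroup.of x) :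
    b ∈ (RealifiedDivisorMonoids.ofRlfQ dm hpf).FΛ Y := by
  obtain ⟨⟨a, n⟩, rfl⟩ := Perfection.mk_surjective b
  change divQ dm hpf Y (Perfection.mk a n) = Algebra.GrothendieckGroup.of x at hbx
  obtain ⟨x₀, hx₀, -⟩ := exists_div₀_eq_of_divQ_mk_eq_of Y a n x hbx
  have ha : a ∈ dm.F₀ Y := h34 Y a x₀ hx₀
  -- `a^{1/n} = ((a : F₀)^{1/n})` lies in the image of `F₀(Y)^pf → B₀(Y)^pf`
  change Perfection.mk a n ∈ MonoidHom.mrange (Perfection.map (dm.F₀ Y).subtype)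
  exact ⟨Perfection.mk ⟨a, ha⟩ n, rfl⟩

/-- The same from the typed Prop. 3.4 hypothesis structure `DivisorMonoids.Prop34`.
[cite: MochizukiEtTh2009, Prop 3.4 (ii) p.74] -/
theorem ofRlfQ_mem_FΛ_of_divΛ_eq_of' {V : FrdIMonoidStub.{w}} {V₀ : FrdICatStub.{u, v, w} D₀}
    (h34 : dm.Prop34 V V₀) (Y : D₀ᵒᵖ) (b : (RealifiedDivisorMonoids.ofRlfQ dm hpf).BΛ.obj Y)
    (x : (RealifiedDivisorMonoids.ofRlfQ dm hpf).ΦR.obj Y)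
    (hbx : (RealifiedDivisorMonoids.ofRlfQ dm hpf).divΛ Y b = Algebra.GrothendieckGroup.of x) :
    b ∈ (RealifiedDivisorMonoids.ofRlfQ dm hpf).FΛ Y :=
  ofRlfQ_mem_FΛ_of_divΛ_eq_of h34.mem_F₀_of_div₀_mem Y b x hbx

/-! ### Clauses 2–3: naturality through `cnst` transports to the perfection -/

/-- **Clause 2 at `Λ = ℚ`**: morphisms `g, g'` of `D₀` with the same image in `D^cnst` pull back every element of
`F₀^ℚ(Y') = F₀(Y')^pf` identically — `B₀^pf(g)` acts on `a^{1/n}` through `B₀(g) a`, and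
`Prop34Cnst₀.B₀_map_eq_of_cnst_map_eq` on `F₀`. [cite: MochizukiEtTh2009, Prop 3.4 (ii) p.74] -/
theorem ofRlfQ_BΛ_map_eq (h₀ : dm.Prop34Cnst₀ cnst) {Y Y' : D₀} (g g' : Y ⟶ Y')
    (hg : cnst.map g = cnst.map g') (b : (RealifiedDivisorMonoids.ofRlfQ dm hpf).BΛ.obj (op Y'))
    (hb : b ∈ (RealifiedDivisorMonoids.ofRlfQ dm hpf).FΛ (op Y')) :
    ((RealifiedDivisorMonoids.ofRlfQ dm hpf).BΛ.map g.op).hom b =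
      ((RealifiedDivisorMonoids.ofRlfQ dm hpf).BΛ.map g'.op).hom b := by
  obtain ⟨xF, rfl⟩ := hb
  obtain ⟨⟨a, n⟩, rfl⟩ := Perfection.mk_surjective xF
  change Perfection.map (dm.B₀.map g.op).hom (Perfection.map (dm.F₀ (op Y')).subtype (Perfection.mk a n)) =
    Perfection.map (dm.B₀.map g'.op).hom (Perfection.map (dm.F₀ (op Y')).subtype (Perfection.mk a n))
  rw [Perfection.map_mk, Perfection.map_mk, Perfection.map_mk]
  exact congrArg (Perfection.mk · n) (h₀.B₀_map_eq_of_cnst_map_eq g g' hg (a : dm.B₀.obj (op Y')) a.2)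

/-- **Clause 3 at `Λ = ℚ`**: morphisms `g, g'` with the same image in `D^cnst` pull back identically every
`x ∈ Φ₀(Y')^rlf` that is the image of an element of `F₀(Y')^pf` — `x^n = ι(x₀)` for a log-divisor `x₀` of a
constant, on which `Prop34Cnst₀.Φ₀_map_eq_of_cnst_map_eq` applies, and `n`-th powers are injective in
`Φ₀(Y)^rlf`. [cite: MochizukiEtTh2009, Prop 3.4 (ii) p.74] -/
theorem ofRlfQ_ΦR_map_eq (h₀ : dm.Prop34Cnst₀ cnst) {Y Y' : D₀} (g g' : Y ⟶ Y')
    (hg : cnst.map g = cnst.map g') (x : (RealifiedDivisorMonoids.ofRlfQ dm hpf).ΦR.obj (op Y'))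
    (hx : ∃ b ∈ (RealifiedDivisorMonoids.ofRlfQ dm hpf).FΛ (op Y'),
      (RealifiedDivisorMonoids.ofRlfQ dm hpf).divΛ (op Y') b = Algebra.GrothendieckGroup.of x) :
    ((RealifiedDivisorMonoids.ofRlfQ dm hpf).ΦR.map g.op).hom x =
      ((RealifiedDivisorMonoids.ofRlfQ dm hpf).ΦR.map g'.op).hom x := by
  obtain ⟨b, ⟨xF, rfl⟩, hbx⟩ := hx
  obtain ⟨⟨a, n⟩, rfl⟩ := Perfection.mk_surjective xF
  change divQ dm hpf (op Y') (Perfection.mk (a : dm.B₀.obj (op Y')) n) = Algebra.GrothendieckGroup.of x at hbx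
  obtain ⟨x₀, hx₀, hxn⟩ := exists_div₀_eq_of_divQ_mk_eq_of (op Y') (a : dm.B₀.obj (op Y')) n x hbx
  -- `Φ₀(g) x₀ = Φ₀(g') x₀` for the log-divisor of the constant `a`
  have hΦ : (dm.Φ₀.map g.op).hom x₀ = (dm.Φ₀.map g'.op).hom x₀ :=
    h₀.Φ₀_map_eq_of_cnst_map_eq g g' hg x₀ ⟨(a : dm.B₀.obj (op Y')), a.2, hx₀⟩
  -- work with the realification functor itself (`T.ΦR = rlfFunctor Φ₀` definitionally)
  change ((rlfFunctor dm.Φ₀ hpf).map g.op).hom x = ((rlfFunctor dm.Φ₀ hpf).map g'.op).hom x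
  -- the `n`-th powers of the two pull-backs agree: they are the pull-backs of `ι(x₀)`
  have key : ((rlfFunctor dm.Φ₀ hpf).map g.op).hom x ^ (n : ℕ) =
      ((rlfFunctor dm.Φ₀ hpf).map g'.op).hom x ^ (n : ℕ) := by
    rw [← map_pow, ← map_pow, hxn]
    change rlfMap dm.Φ₀ hpf g.op ((hpf (op Y')).toRealification (Perfection.of _ x₀)) =
      rlfMap dm.Φ₀ hpf g'.op ((hpf (op Y')).toRealification (Perfection.of _ x₀))
    rw [rlfMap_toRealification_of, rlfMap_toRealification_of, hΦ]
  -- `n`-th powers are injective in `Φ₀(Y)^rlf`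
  exact ((IsPerfFactorial.Rlf.isPerfect (hpf (op Y))).bijective_pow (n : ℕ) n.pos).1 key

/-! ### Clause 4: faithfulness up to torsion is the exact residual -/

/-- From the `B₀`-level faithfulness UP TO TORSION (the binder `hQ`): automorphisms of `Y` acting identically on
`Ker(B₀(Y)^pf → (Φ₀^rlf)^gp(Y))` have the same image in `Aut_{D^cnst}(Y^cnst)` — for `b ∈ Ker(div₀)`,
`divQ b = 1`, and equality of `B₀(g) b`, `B₀(g') b` in `B₀(Y)^pf` is equality in `B₀(Y)` up to torsion.
[cite: MochizukiEtTh2009, Thm 3.7 (iii) p.80] -/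
theorem ofRlfQ_cnst_map_eq
    (hQ : ∀ {Y : D₀} (g g' : Y ≅ Y),
      (∀ b : dm.B₀.obj (op Y), dm.div₀ (op Y) b = 1 →
        ∃ N : ℕ+, ((dm.B₀.map g.hom.op).hom b) ^ (N : ℕ) = ((dm.B₀.map g'.hom.op).hom b) ^ (N : ℕ)) →
      cnst.map g.hom = cnst.map g'.hom)
    {Y : D₀} (g g' : Y ≅ Y)
    (hker : ∀ b : (RealifiedDivisorMonoids.ofRlfQ dm hpf).BΛ.obj (op Y),
      (RealifiedDivisorMonoids.ofRlfQ dm hpf).divΛ (op Y) b = 1 →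
        ((RealifiedDivisorMonoids.ofRlfQ dm hpf).BΛ.map g.hom.op).hom b =
          ((RealifiedDivisorMonoids.ofRlfQ dm hpf).BΛ.map g'.hom.op).hom b) :
    cnst.map g.hom = cnst.map g'.hom := by
  refine hQ g g' fun b hb => ?_
  have h1 : (RealifiedDivisorMonoids.ofRlfQ dm hpf).divΛ (op Y) (Perfection.of _ b) = 1 := by
    change divQ dm hpf (op Y) (Perfection.of _ b) = 1
    rw [divQ_of]
    change gpMap ((toRlfNatTrans dm.Φ₀ hpf).app (op Y)).hom (dm.div₀ (op Y) b) = 1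
    rw [hb, map_one]
  have h2 := hker (Perfection.of _ b) h1
  change Perfection.map (dm.B₀.map g.hom.op).hom (Perfection.of _ b) =
    Perfection.map (dm.B₀.map g'.hom.op).hom (Perfection.of _ b) at h2
  rw [Perfection.of_apply, Perfection.map_mk, Perfection.map_mk, ← Perfection.of_apply,
    ← Perfection.of_apply, Perfection.of_eq_of_iff] at h2
  exact h2

/-- **Conversely, `hQ` is NECESSARY**: the faithfulness clause of `Prop34Cnst (ofRlfQ dm hpf) cnst` yields the
`B₀`-level faithfulness up to torsion — an element of `Ker(div₀)` maps to `Ker(divQ)` (its image in `(Φ₀^rlf)^gp`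
is `ι(div₀ b) = 1`), and `B₀(g) b`, `B₀(g') b` agreeing up to torsion have equal images in `B₀(Y)^pf`.  So the
residual of clause 4 at `Λ = ℚ` is EXACTLY `hQ`. [cite: MochizukiEtTh2009, Thm 3.7 (iii) p.80] -/
theorem torsionFaithful_of_prop34Cnst_ofRlfQ (h : (RealifiedDivisorMonoids.ofRlfQ dm hpf).Prop34Cnst cnst)
    {Y : D₀} (g g' : Y ≅ Y)
    (hb : ∀ b : dm.B₀.obj (op Y), dm.div₀ (op Y) b = 1 →
      ∃ N : ℕ+, ((dm.B₀.map g.hom.op).hom b) ^ (N : ℕ) = ((dm.B₀.map g'.hom.op).hom b) ^ (N : ℕ)) :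
    cnst.map g.hom = cnst.map g'.hom := by
  refine h.cnst_map_eq_of_BΛ_map_eq (Or.inr rfl) g g' fun b' hb' => ?_
  obtain ⟨⟨a, n⟩, rfl⟩ := Perfection.mk_surjective b'
  change divQ dm hpf (op Y) (Perfection.mk a n) = 1 at hb'
  -- `div₀ a = 1`: its image `ι(div₀ a) = (divQ a^{1/n})^n = 1` is effective, so `div₀ a = [x₀]` with `ι x₀ = 1`
  obtain ⟨x₀, hx₀, hxn⟩ := exists_div₀_eq_of_divQ_mk_eq_of (op Y) a n
    (1 : (rlfFunctor dm.Φ₀ hpf).obj (op Y)) (hb'.trans (map_one _).symm)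
  rw [one_pow] at hxn
  have hx₀1 : x₀ = 1 := by
    have hinj : Function.Injective ((hpf (op Y)).toRealification.comp (Perfection.of (dm.Φ₀.obj (op Y)))) :=
      (IsPerfFactorial.Rlf.toRealification_injective (hpf (op Y))).comp
        (of_injective_of_isSharp_isIntegral_isSaturated (hpf (op Y)).isDivisorial.isSharp
          (hpf (op Y)).isDivisorial.isPreDivisorial.isIntegral
          (hpf (op Y)).isDivisorial.isPreDivisorial.isSaturated)
    apply hinj
    rw [map_one]
    exact hxn.symm
  rw [hx₀1, map_one] at hx₀
  obtain ⟨N, hN⟩ := hb a hx₀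
  -- equality in `B₀(Y)^pf` of the pull-backs of `a^{1/n}`
  change Perfection.map (dm.B₀.map g.hom.op).hom (Perfection.mk a n) =
    Perfection.map (dm.B₀.map g'.hom.op).hom (Perfection.mk a n)
  rw [Perfection.map_mk, Perfection.map_mk, Perfection.mk_eq_mk_iff]
  exact ⟨N, by rw [pow_mul, pow_mul, hN]⟩

/-! ### Assembly -/

/-- **Prop. 3.4 (ii) relative to `D^cnst` for the constructed Def. 3.6 (i) data of monoid type `ℚ`**: for
`T = ofRlfQ dm hpf`, the clauses `Prop34Cnst T cnst` follow from the typed Prop. 3.4 (ii) at the `B₀`-level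
(iso 2: effective locus `⊆ F₀`), the `B₀`-level naturality clauses `Prop34Cnst₀ cnst`, and the `B₀`-level
faithfulness up to torsion `hQ` (print's `Λ = ℚ` clause of Thm. 3.7 (iii); exactly necessary by
`torsionFaithful_of_prop34Cnst_ofRlfQ`). [cite: MochizukiEtTh2009, Prop 3.4 (ii) p.74] -/
theorem ofRlfQ_of_torsionFaithful
    (h34 : ∀ (Y : D₀ᵒᵖ) (b : dm.B₀.obj Y) (x : dm.Φ₀.obj Y),
      dm.div₀ Y b = Algebra.GrothendieckGroup.of x → b ∈ dm.F₀ Y)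
    (h₀ : dm.Prop34Cnst₀ cnst)
    (hQ : ∀ {Y : D₀} (g g' : Y ≅ Y),
      (∀ b : dm.B₀.obj (op Y), dm.div₀ (op Y) b = 1 →
        ∃ N : ℕ+, ((dm.B₀.map g.hom.op).hom b) ^ (N : ℕ) = ((dm.B₀.map g'.hom.op).hom b) ^ (N : ℕ)) →
      cnst.map g.hom = cnst.map g'.hom) :
    (RealifiedDivisorMonoids.ofRlfQ dm hpf).Prop34Cnst cnst where
  mem_FΛ_of_divΛ_eq_of := ofRlfQ_mem_FΛ_of_divΛ_eq_of h34
  BΛ_map_eq_of_cnst_map_eq g g' hg b hb := ofRlfQ_BΛ_map_eq h₀ g g' hg b hb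
  ΦR_map_eq_of_cnst_map_eq g g' hg x hx := ofRlfQ_ΦR_map_eq h₀ g g' hg x hx
  cnst_map_eq_of_BΛ_map_eq _ _ g g' hker := ofRlfQ_cnst_map_eq hQ g g' hker

/-- The same with the typed `DivisorMonoids.Prop34` as input. [cite: MochizukiEtTh2009, Prop 3.4 (ii) p.74] -/
theorem ofRlfQ {V : FrdIMonoidStub.{w}} {V₀ : FrdICatStub.{u, v, w} D₀} (h34 : dm.Prop34 V V₀)
    (h₀ : dm.Prop34Cnst₀ cnst)
    (hQ : ∀ {Y : D₀} (g g' : Y ≅ Y),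
      (∀ b : dm.B₀.obj (op Y), dm.div₀ (op Y) b = 1 →
        ∃ N : ℕ+, ((dm.B₀.map g.hom.op).hom b) ^ (N : ℕ) = ((dm.B₀.map g'.hom.op).hom b) ^ (N : ℕ)) →
      cnst.map g.hom = cnst.map g'.hom) :
    (RealifiedDivisorMonoids.ofRlfQ dm hpf).Prop34Cnst cnst :=
  ofRlfQ_of_torsionFaithful h34.mem_F₀_of_div₀_mem h₀ hQ

/-- The `B₀`-level faithfulness clause of `Prop34Cnst₀` is the torsion-free shadow of `hQ`: if `B₀(Y)` has no
torsion beyond `1` on `Ker(div₀)` — every `u` with `div₀ u = 1` and `u^N = 1` is `1` — then `hQ` FOLLOWS from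
`Prop34Cnst₀.cnst_map_eq_of_B₀_map_eq` (agreement up to torsion of the two pull-backs is then agreement, the
quotient `B₀(g) b / B₀(g') b` being a torsion element of `Ker(div₀)`).  (In print `Ker(div₀) = O_L^×` HAS
torsion, so this reduction is not available there; it records precisely what separates `hQ` from `Prop34Cnst₀`.)
[cite: MochizukiEtTh2009, Thm 3.7 (iii) p.80] -/
theorem torsionFaithful_of_prop34Cnst₀_of_torsionFree (h₀ : dm.Prop34Cnst₀ cnst)
    (htf : ∀ (Y : D₀) (u : dm.B₀.obj (op Y)) (N : ℕ+), dm.div₀ (op Y) u = 1 → u ^ (N : ℕ) = 1 → u = 1)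
    {Y : D₀} (g g' : Y ≅ Y)
    (hb : ∀ b : dm.B₀.obj (op Y), dm.div₀ (op Y) b = 1 →
      ∃ N : ℕ+, ((dm.B₀.map g.hom.op).hom b) ^ (N : ℕ) = ((dm.B₀.map g'.hom.op).hom b) ^ (N : ℕ)) :
    cnst.map g.hom = cnst.map g'.hom := by
  refine h₀.cnst_map_eq_of_B₀_map_eq g g' fun b hdb => ?_
  obtain ⟨N, hN⟩ := hb b hdb
  -- the two pull-backs are units of `B₀(Y)` with trivial divisor; their quotient is `N`-torsion
  obtain ⟨c, hc⟩ := (dm.isUnit_B₀ (op Y) ((dm.B₀.map g'.hom.op).hom b)).exists_right_inv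
  have hdiv : dm.div₀ (op Y) ((dm.B₀.map g.hom.op).hom b * c) = 1 := by
    have hg1 : dm.div₀ (op Y) ((dm.B₀.map g.hom.op).hom b) = 1 := by
      rw [dm.div₀_natural g.hom.op b, hdb, map_one]
    have hg'1 : dm.div₀ (op Y) ((dm.B₀.map g'.hom.op).hom b) = 1 := by
      rw [dm.div₀_natural g'.hom.op b, hdb, map_one]
    have hc1 : dm.div₀ (op Y) c = 1 := by
      have := congrArg (dm.div₀ (op Y)) hc
      rw [map_mul, hg'1, one_mul, map_one] at this
      exact this
    rw [map_mul, hg1, hc1, one_mul]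
  have hpow : ((dm.B₀.map g.hom.op).hom b * c) ^ (N : ℕ) = 1 := by
    rw [mul_pow, hN, ← mul_pow, hc, one_pow]
  have h1 := htf Y _ N hdiv hpow
  -- `B₀(g) b · c = 1` and `B₀(g') b · c = 1` give `B₀(g) b = B₀(g') b`
  calc (dm.B₀.map g.hom.op).hom b
      = (dm.B₀.map g.hom.op).hom b * (c * (dm.B₀.map g'.hom.op).hom b) := by rw [mul_comm c, hc, mul_one]
    _ = ((dm.B₀.map g.hom.op).hom b * c) * (dm.B₀.map g'.hom.op).hom b := by rw [mul_assoc]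
    _ = (dm.B₀.map g'.hom.op).hom b := by rw [h1, one_mul]

end RealifiedDivisorMonoids.Prop34Cnst

/-! ### Theorem 3.7 (iii) over the constructed data of monoid type `ℚ` -/

namespace TemperedFrobenioid

variable {D₀ : Type u} [Category.{v} D₀] {dm : DivisorMonoids.{u, v, w} D₀}
  {hpf : ∀ Y : D₀ᵒᵖ, IsPerfFactorial (dm.Φ₀.obj Y)} {V : FrdIMonoidStub.{w}}
  {V₀ : FrdICatStub.{u, v, w} D₀} {D : Type u₀} [Category.{v₀} D] {VD : FrdICatStub.{u₀, v₀, w} D}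
  (C₀ : TemperedFrobenioid (RealifiedDivisorMonoids.ofRlfQ dm hpf) D VD)
  {Dcnst : Type u₁} [Category.{v₁} Dcnst] {cnst : D₀ ⥤ Dcnst}

/-- **Theorem 3.7 (iii) for a tempered Frobenioid (of monoid type `ℚ`) over the CONSTRUCTED Def. 3.6 (i)
data `ofRlfQ dm hpf`**, at the instantiated facade, modulo statements about the Def. 3.3 (iii) data only:
the typed Prop. 3.4 (ii) `dm.Prop34`, its naturality clauses `dm.Prop34Cnst₀ cnst`, and the `B₀`-level
faithfulness up to torsion `hQ`. [cite: MochizukiEtTh2009, Thm 3.7 (iii) p.79] -/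
theorem thm37_iii_withCnst_ofRlfQ (F : FrobenioidFacade.{u₀, v₀, w} D) (h34 : dm.Prop34 V V₀)
    (h₀ : dm.Prop34Cnst₀ cnst)
    (hQ : ∀ {Y : D₀} (g g' : Y ≅ Y),
      (∀ b : dm.B₀.obj (op Y), dm.div₀ (op Y) b = 1 →
        ∃ N : ℕ+, ((dm.B₀.map g.hom.op).hom b) ^ (N : ℕ) = ((dm.B₀.map g'.hom.op).hom b) ^ (N : ℕ)) →
      cnst.map g.hom = cnst.map g'.hom) :
    C₀.Thm37_iii (F.withCnst (C₀.base ⋙ cnst)) :=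
  C₀.thm37_iii_withCnst F (RealifiedDivisorMonoids.Prop34Cnst.ofRlfQ h34 h₀ hQ)

end TemperedFrobenioid

end Literature.AnabelianGeometry.EtaleTheta

end
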